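import Literature.NumberTheory.LFunctions.WeilFirstPrimeCertificateDataC
import HarnessLib

/-!
# First-prime Weil positivity, stage C: the value of κ and the moment table

Part of `weilCert3C.check` (`WeilFirstPrimeCertificateDataC.lean`), evaluated by `decide +kernel` and kept in its own
file for kernel time and memory (each declaration is checked separately). Assembled in
`WeilFirstPrimeCertificateCCheck.lean`. Pure proof file; nothing is asserted.
-/

noncomputable section

namespace Literature.NumberTheory.LFunctions

set_option maxHeartbeats 0 in
/-- **The value of `κ`** of the stage-C first-prime certificate (kernel evaluation, once). [folklore] -/
theorem kappaQ_weilCert3C : weilCert3C.kappaQ = (23264065549356049135287148592400665151/21267647932558653966460912964485513216 : ℚ) := by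
  decide +kernel

/-- The moment table of the certificate is its data list. [folklore] -/
theorem nuTab_weilCert3C : weilCert3C.nuTab = weilCert3CNuData := rfl

end Literature.NumberTheory.LFunctions
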